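import Mathlib
import Summits.Ventures.PercRepro2.M9QuadHarrisPow

/-!
# The sum algebra of the unit assembly (blind cell PercRepro2, p3 g36, 2026-08-29;
`proofs/P3-NPHDR.md` §5(d)–(e), the bookkeeping)

Pure `Finset`-sum identities used by the unit assembly of THEOREM RK-NP, stated for arbitrary
finite sets `𝔉` (the free blocks), `𝔉L ⊆ 𝔉` (the linking ones) and `𝔑` (the joined blocks):
the reindexing of a double sum by the complements `T ↦ 𝔉 ∖ T`, `S ↦ 𝔑 ∖ S`
(`sum_sdiff_sdiff_eq`), the bijections `T ↦ T ∪ 𝔉L` and `T ↦ 𝔉 ∖ T` between the block sets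
missing `𝔉L` and those containing it (`sum_filter_inter_empty_eq_sum_union`,
`sum_filter_inter_empty_eq_sum_sdiff`), and the two collections of the uniform sign formulas:
**the doubly-reached part** `Σ_T Σ_{S proper} y (T ∪ S) · ([T ∩ 𝔉L = ∅](1 − ℓ S) −
[𝔉L ⊆ T](1 − ℓ (𝔑 ∖ S))) = Σ_{S proper} (1 − ℓ S)·(HY S − HW (𝔑 ∖ S))` with `HY`, `HW` the
sums over the two kinds of block sets (`sum_E_algebra`), and **the one-sided part**
`Σ_T f T · ([T ∩ 𝔉L = ∅] − [𝔉L ⊆ T](1 − c)) = A − (1 − c)·B` (`sum_K_algebra`).  Own work;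
std axioms.
-/

namespace Summit.Ventures.PercRepro2

namespace M9Reduce

open Finset

variable {β : Type*} [DecidableEq β]

/-- Reindexing a double sum over the subsets of `𝔉` and the proper subsets of `𝔑` by the
complements. -/
lemma sum_sdiff_sdiff_eq (𝔉 𝔑 : Finset β) (g : Finset β → ℤ) :
    ∑ T ∈ 𝔉.powerset, ∑ S ∈ 𝔑.powerset.filter (fun S => S ≠ ∅ ∧ S ≠ 𝔑), g ((𝔉 \ T) ∪ (𝔑 \ S)) =
      ∑ T ∈ 𝔉.powerset, ∑ S ∈ 𝔑.powerset.filter (fun S => S ≠ ∅ ∧ S ≠ 𝔑), g (T ∪ S) := by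
  have inner : ∀ T : Finset β,
      ∑ S ∈ 𝔑.powerset.filter (fun S => S ≠ ∅ ∧ S ≠ 𝔑), g ((𝔉 \ T) ∪ (𝔑 \ S)) =
        ∑ S ∈ 𝔑.powerset.filter (fun S => S ≠ ∅ ∧ S ≠ 𝔑), g ((𝔉 \ T) ∪ S) := by
    intro T
    refine Finset.sum_nbij' (fun S => 𝔑 \ S) (fun S => 𝔑 \ S) (fun S hS => sdiff_mem_properOf hS)
      (fun S hS => sdiff_mem_properOf hS)
      (fun S hS => Finset.sdiff_sdiff_eq_self (mem_properOf.1 hS).1)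
      (fun S hS => Finset.sdiff_sdiff_eq_self (mem_properOf.1 hS).1) (fun S _ => rfl)
  simp_rw [inner]
  refine Finset.sum_nbij' (fun T => 𝔉 \ T) (fun T => 𝔉 \ T)
    (fun T _ => Finset.mem_powerset.2 Finset.sdiff_subset)
    (fun T _ => Finset.mem_powerset.2 Finset.sdiff_subset)
    (fun T hT => Finset.sdiff_sdiff_eq_self (Finset.mem_powerset.1 hT))
    (fun T hT => Finset.sdiff_sdiff_eq_self (Finset.mem_powerset.1 hT)) (fun T _ => rfl)

/-- The block sets missing `𝔉L` correspond to those containing it by `T ↦ T ∪ 𝔉L`. -/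
lemma sum_filter_inter_empty_eq_sum_union {𝔉 𝔉L : Finset β} (h : 𝔉L ⊆ 𝔉)
    (f : Finset β → ℤ) :
    ∑ T ∈ 𝔉.powerset.filter (fun T => T ∩ 𝔉L = ∅), f (T ∪ 𝔉L) =
      ∑ T ∈ 𝔉.powerset.filter (fun T => 𝔉L ⊆ T), f T := by
  refine Finset.sum_nbij' (fun T => T ∪ 𝔉L) (fun T => T \ 𝔉L) ?_ ?_ ?_ ?_ (fun T _ => rfl)
  · intro T hT
    obtain ⟨hT, _⟩ := Finset.mem_filter.1 hT
    exact Finset.mem_filter.2 ⟨Finset.mem_powerset.2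
      (Finset.union_subset (Finset.mem_powerset.1 hT) h), Finset.subset_union_right⟩
  · intro T hT
    obtain ⟨hT, _⟩ := Finset.mem_filter.1 hT
    exact Finset.mem_filter.2 ⟨Finset.mem_powerset.2
      (Finset.sdiff_subset.trans (Finset.mem_powerset.1 hT)), Finset.sdiff_inter_self _ _⟩
  · intro T hT
    obtain ⟨_, hTL⟩ := Finset.mem_filter.1 hT
    rw [Finset.union_sdiff_right, Finset.sdiff_eq_self_iff_disjoint]
    exact Finset.disjoint_iff_inter_eq_empty.2 hTL
  · intro T hT
    obtain ⟨_, hTL⟩ := Finset.mem_filter.1 hT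
    exact Finset.sdiff_union_of_subset hTL

/-- The block sets missing `𝔉L` correspond to those containing it by `T ↦ 𝔉 ∖ T`. -/
lemma sum_filter_inter_empty_eq_sum_sdiff {𝔉 𝔉L : Finset β} (h : 𝔉L ⊆ 𝔉)
    (f : Finset β → ℤ) :
    ∑ T ∈ 𝔉.powerset.filter (fun T => T ∩ 𝔉L = ∅), f (𝔉 \ T) =
      ∑ T ∈ 𝔉.powerset.filter (fun T => 𝔉L ⊆ T), f T := by
  refine Finset.sum_nbij' (fun T => 𝔉 \ T) (fun T => 𝔉 \ T) ?_ ?_ ?_ ?_ (fun T _ => rfl)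
  · intro T hT
    obtain ⟨_, hTL⟩ := Finset.mem_filter.1 hT
    refine Finset.mem_filter.2 ⟨Finset.mem_powerset.2 Finset.sdiff_subset, ?_⟩
    intro C hC
    refine Finset.mem_sdiff.2 ⟨h hC, fun hCT => ?_⟩
    have : C ∈ T ∩ 𝔉L := Finset.mem_inter.2 ⟨hCT, hC⟩
    rw [hTL] at this
    exact Finset.notMem_empty C this
  · intro T hT
    obtain ⟨_, hTL⟩ := Finset.mem_filter.1 hT
    refine Finset.mem_filter.2 ⟨Finset.mem_powerset.2 Finset.sdiff_subset, ?_⟩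
    rw [Finset.eq_empty_iff_forall_notMem]
    intro C hC
    obtain ⟨hC1, hC2⟩ := Finset.mem_inter.1 hC
    exact (Finset.mem_sdiff.1 hC1).2 (hTL hC2)
  · intro T hT
    exact Finset.sdiff_sdiff_eq_self (Finset.mem_powerset.1 (Finset.mem_filter.1 hT).1)
  · intro T hT
    exact Finset.sdiff_sdiff_eq_self (Finset.mem_powerset.1 (Finset.mem_filter.1 hT).1)

omit [DecidableEq β] in
/-- The sum over `T` of an indicator times a function is the sum over the filter. -/
lemma sum_mul_indicator (𝔉 : Finset β) (P : Finset β → Prop) [DecidablePred P]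
    (f : Finset β → ℤ) :
    ∑ T ∈ 𝔉.powerset, f T * (if P T then 1 else 0) = ∑ T ∈ 𝔉.powerset.filter P, f T := by
  rw [Finset.sum_filter]
  refine Finset.sum_congr rfl (fun T _ => ?_)
  split_ifs <;> simp

/-- **The doubly-reached part of a unit**, collected by the joined `W`-side set. -/
theorem sum_E_algebra (𝔉 𝔉L 𝔑 : Finset β) (y ℓ : Finset β → ℤ) :
    ∑ T ∈ 𝔉.powerset, ∑ S ∈ 𝔑.powerset.filter (fun S => S ≠ ∅ ∧ S ≠ 𝔑),
        y (T ∪ S) * ((if T ∩ 𝔉L = ∅ then 1 else 0) * (1 - ℓ S) -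
          (if 𝔉L ⊆ T then 1 else 0) * (1 - ℓ (𝔑 \ S))) =
      ∑ S ∈ 𝔑.powerset.filter (fun S => S ≠ ∅ ∧ S ≠ 𝔑), (1 - ℓ S) *
        (∑ T ∈ 𝔉.powerset.filter (fun T => T ∩ 𝔉L = ∅), y (T ∪ S) -
          ∑ T ∈ 𝔉.powerset.filter (fun T => 𝔉L ⊆ T), y (T ∪ (𝔑 \ S))) := by
  rw [Finset.sum_comm]
  have h1 : ∀ S ∈ 𝔑.powerset.filter (fun S => S ≠ ∅ ∧ S ≠ 𝔑),
      ∑ T ∈ 𝔉.powerset, y (T ∪ S) * ((if T ∩ 𝔉L = ∅ then 1 else 0) * (1 - ℓ S) -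
          (if 𝔉L ⊆ T then 1 else 0) * (1 - ℓ (𝔑 \ S))) =
        (1 - ℓ S) * ∑ T ∈ 𝔉.powerset.filter (fun T => T ∩ 𝔉L = ∅), y (T ∪ S) -
          (1 - ℓ (𝔑 \ S)) * ∑ T ∈ 𝔉.powerset.filter (fun T => 𝔉L ⊆ T), y (T ∪ S) := by
    intro S _
    rw [← sum_mul_indicator 𝔉 (fun T => T ∩ 𝔉L = ∅) (fun T => y (T ∪ S)),
      ← sum_mul_indicator 𝔉 (fun T => 𝔉L ⊆ T) (fun T => y (T ∪ S)), Finset.mul_sum,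
      Finset.mul_sum, ← Finset.sum_sub_distrib]
    refine Finset.sum_congr rfl (fun T _ => ?_)
    ring
  rw [Finset.sum_congr rfl h1, Finset.sum_sub_distrib]
  have h2 : ∑ S ∈ 𝔑.powerset.filter (fun S => S ≠ ∅ ∧ S ≠ 𝔑),
      (1 - ℓ (𝔑 \ S)) * ∑ T ∈ 𝔉.powerset.filter (fun T => 𝔉L ⊆ T), y (T ∪ S) =
      ∑ S ∈ 𝔑.powerset.filter (fun S => S ≠ ∅ ∧ S ≠ 𝔑),
        (1 - ℓ S) * ∑ T ∈ 𝔉.powerset.filter (fun T => 𝔉L ⊆ T), y (T ∪ (𝔑 \ S)) := by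
    refine Finset.sum_nbij' (fun S => 𝔑 \ S) (fun S => 𝔑 \ S) (fun S hS => sdiff_mem_properOf hS)
      (fun S hS => sdiff_mem_properOf hS)
      (fun S hS => Finset.sdiff_sdiff_eq_self (mem_properOf.1 hS).1)
      (fun S hS => Finset.sdiff_sdiff_eq_self (mem_properOf.1 hS).1) (fun S hS => ?_)
    rw [Finset.sdiff_sdiff_eq_self (mem_properOf.1 hS).1]
  rw [h2, ← Finset.sum_sub_distrib]
  refine Finset.sum_congr rfl (fun S _ => ?_)
  ring

/-- **The one-sided part of a dead pattern**, collected by the side of the linking free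
blocks. -/
theorem sum_K_algebra (𝔉 𝔉L : Finset β) (f : Finset β → ℤ) (c : ℤ) :
    ∑ T ∈ 𝔉.powerset, f T * ((if T ∩ 𝔉L = ∅ then 1 else 0) -
        (if 𝔉L ⊆ T then 1 else 0) * (1 - c)) =
      ∑ T ∈ 𝔉.powerset.filter (fun T => T ∩ 𝔉L = ∅), f T -
        (1 - c) * ∑ T ∈ 𝔉.powerset.filter (fun T => 𝔉L ⊆ T), f T := by
  rw [← sum_mul_indicator 𝔉 (fun T => T ∩ 𝔉L = ∅) f,
    ← sum_mul_indicator 𝔉 (fun T => 𝔉L ⊆ T) f, Finset.mul_sum, ← Finset.sum_sub_distrib]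
  refine Finset.sum_congr rfl (fun T _ => ?_)
  ring

end M9Reduce

end Summit.Ventures.PercRepro2
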